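import Mathlib
import HarnessLib

/-!
# Crux `CwThesis` (stmt-HubbardSuperconductivity-10438, route `ChiralWindow`), line
`SketchIdeator3` (penalty line, v5 anchor branch) — stub `stub_signDecoupling`

**Sign-decoupling identity** (helper for the averaging step of the line): for `J` cells and
`i j : Fin J`,

`∑_{s : Fin J → Bool} σ(s i) σ(s j) = 2^J · [i = j]`, where `σ(true) = 1`, `σ(false) = -1`.

Averaging the quadratic pairing form of a sign-modulated gap function over all `2^J` sign
patterns decouples distinct cells through this identity.

Proof: for `i = j` every summand is `σ² = 1` and `Fintype.card (Fin J → Bool) = 2^J`; for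
`i ≠ j` the involution `s ↦ Function.update s i (!s i)` flips `σ(s i)` and fixes `σ(s j)`, so it
negates the summand and the sum vanishes (`Finset.sum_ninvolution`).

No definition is introduced. [folklore]
-/

namespace Summit.HubbardSuperconductivity.HubbardSuperconductivity.Theorems.CwThesis

-- the tree's namespace repeats the summit name by design (D-0017)
set_option linter.dupNamespace false

/-- **Sign decoupling**: `∑_{s : Fin J → Bool} σ(s i) σ(s j)` equals `2^J` if `i = j` and `0`
otherwise, where `σ(true) = 1`, `σ(false) = -1`. [folklore] -/
theorem stub_signDecoupling (J : ℕ) (i j : Fin J) :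
    ∑ s : Fin J → Bool, ((if s i then (1:ℝ) else -1) * (if s j then (1:ℝ) else -1)) =
      if i = j then (2:ℝ) ^ J else 0 := by
  by_cases hij : i = j
  · subst hij
    have h : ∀ s : Fin J → Bool,
        ((if s i then (1:ℝ) else -1) * (if s i then (1:ℝ) else -1)) = 1 := fun s => by
      cases s i <;> norm_num
    simp only [if_true, h, Finset.sum_const, Finset.card_univ, Fintype.card_fun,
      Fintype.card_bool, Fintype.card_fin, nsmul_eq_mul, mul_one, Nat.cast_pow, Nat.cast_ofNat]
  · rw [if_neg hij]
    have hji : j ≠ i := fun h => hij h.symm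
    refine Finset.sum_ninvolution (fun s => Function.update s i (!s i)) ?_ ?_ ?_ ?_
    · intro s
      simp only [Function.update_self, Function.update_of_ne hji]
      cases s i <;> cases s j <;> norm_num
    · intro s _ hs
      have := congr_fun hs i
      simp at this
    · intro s
      exact Finset.mem_univ _
    · intro s
      simp

end Summit.HubbardSuperconductivity.HubbardSuperconductivity.Theorems.CwThesis
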